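import Summits.MatrixMultiplication.MatrixMultiplication.Theorems.SoloBlindHypergraphFour

/-!
# The hypergraph Kraft conjecture reduces to hypergraphs without degree-2 vertices

Sub-programme (K₃), finite form (♣).  The degree-2 reduction (`SoloBlindHypergraphDegTwo`,
`SoloBlindHypergraphFour`) gives, at a degree-`2` vertex `v` of an admissible hypergraph `(F, P)`, the exact identity
`K(P) = 1/4 + K(P ∖ v)/2` (`soloBlind_hgKraft_degTwo_eq`) with `(F ∖ v, P ∖ v)` admissible.  Hence, by induction
on `|F|`: if the hypergraph Kraft inequality `K ≤ 1/2` holds for all admissible hypergraphs on at most `n` vertices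
WITHOUT a vertex of degree `2` (by `soloBlind_hg_two_le_deg` this means minimum degree `≥ 3` once `|F| ≥ 2`), then it
holds for all admissible hypergraphs on at most `n` vertices (`soloBlind_hgKraft_of_noDegTwo`); and the conjecture
(♣) itself is equivalent to its restriction to such hypergraphs (`soloBlind_hgKraftConj_iff_noDegTwo`).
-/

namespace Summit.MatrixMultiplication.MatrixMultiplication.Theorems

open Finset

variable {W : Type*} [DecidableEq W]

/-- The edges avoiding `v` live on `F ∖ v`. -/
theorem soloBlind_degTwo_edge_subset {F : Finset W} {P : Finset (Finset W)} (hPF : ∀ J ∈ P, J ⊆ F) (v : W) :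
    ∀ J ∈ P.filter (fun J => v ∉ J), J ⊆ F.erase v := by
  intro J hJ
  obtain ⟨hJP, hvJ⟩ := Finset.mem_filter.mp hJ
  intro x hx
  exact Finset.mem_erase.mpr ⟨fun h => hvJ (h ▸ hx), hPF J hJP hx⟩

/-- THE KRAFT IDENTITY AT A DEGREE-`2` VERTEX: `K(P) = 1/4 + K(P ∖ v)/2`. -/
theorem soloBlind_hgKraft_degTwo_eq {F : Finset W} {P : Finset (Finset W)}
    (hadm : soloBlindHgAdmissible F P) {v : W} (hv : v ∈ F) (hdeg : soloBlindHgDeg P v = 2) :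
    soloBlindHgKraft F P = 1 / 4 + soloBlindHgKraft (F.erase v) (P.filter (fun J => v ∉ J)) / 2 := by
  unfold soloBlindHgKraft
  rw [← Finset.add_sum_erase F _ hv, hdeg]
  have hs : ∑ u ∈ F.erase v, (1 / 2 : ℚ) ^ soloBlindHgDeg P u =
      ∑ u ∈ F.erase v, (1 / 2 : ℚ) ^ soloBlindHgDeg (P.filter (fun J => v ∉ J)) u / 2 := by
    refine Finset.sum_congr rfl (fun u hu => ?_)
    obtain ⟨huv, huF⟩ := Finset.mem_erase.mp hu
    rw [soloBlind_degTwo_deg hadm hv hdeg huF huv, pow_succ]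
    ring
  rw [hs, ← Finset.sum_div]
  norm_num

/-- REDUCTION TO HYPERGRAPHS WITHOUT DEGREE-`2` VERTICES: if `K ≤ 1/2` holds for all admissible hypergraphs on
at most `n` vertices none of which has degree `2`, it holds for all admissible hypergraphs on at most `n` vertices. -/
theorem soloBlind_hgKraft_of_noDegTwo (n : ℕ)
    (hyp : ∀ (F : Finset W) (P : Finset (Finset W)), F.card ≤ n → (∀ J ∈ P, J ⊆ F) →
      soloBlindHgAdmissible F P → (∀ v ∈ F, soloBlindHgDeg P v ≠ 2) → soloBlindHgKraft F P ≤ 1 / 2) :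
    ∀ (m : ℕ) (F : Finset W) (P : Finset (Finset W)), F.card ≤ m → m ≤ n → (∀ J ∈ P, J ⊆ F) →
      soloBlindHgAdmissible F P → soloBlindHgKraft F P ≤ 1 / 2
  | 0 => by
      intro F P hF _ hPF hadm
      have hFe : F = ∅ := Finset.card_eq_zero.mp (Nat.le_zero.mp hF)
      exact hyp F P (by rw [hFe, Finset.card_empty]; exact Nat.zero_le n) hPF hadm
        (by rw [hFe]; intro v hv; exact absurd hv (Finset.notMem_empty v))
  | m + 1 => by
      intro F P hF hmn hPF hadm
      by_cases hex : ∃ v ∈ F, soloBlindHgDeg P v = 2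
      · obtain ⟨v, hv, hdeg⟩ := hex
        have hK' : soloBlindHgKraft (F.erase v) (P.filter (fun J => v ∉ J)) ≤ 1 / 2 :=
          soloBlind_hgKraft_of_noDegTwo n hyp m _ _ (by rw [Finset.card_erase_of_mem hv]; omega) (by omega)
            (soloBlind_degTwo_edge_subset hPF v) (soloBlind_hg_degTwo_admissible hPF hadm hv hdeg)
        rw [soloBlind_hgKraft_degTwo_eq hadm hv hdeg]
        linarith
      · push Not at hex
        exact hyp F P (by omega) hPF hadm hex

/-- (♣) IS EQUIVALENT TO ITS RESTRICTION TO ADMISSIBLE HYPERGRAPHS WITHOUT DEGREE-`2` VERTICES. -/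
theorem soloBlind_hgKraftConj_iff_noDegTwo (W : Type*) [DecidableEq W] :
    soloBlindHgKraftConj W ↔
      ∀ (F : Finset W) (P : Finset (Finset W)), (∀ J ∈ P, J ⊆ F) → soloBlindHgAdmissible F P →
        (∀ v ∈ F, soloBlindHgDeg P v ≠ 2) → soloBlindHgKraft F P ≤ 1 / 2 := by
  constructor
  · intro h F P hPF hadm _
    exact h F P hPF hadm
  · intro h F P hPF hadm
    exact soloBlind_hgKraft_of_noDegTwo F.card (fun F' P' _ hPF' hadm' hno => h F' P' hPF' hadm' hno)
      F.card F P le_rfl le_rfl hPF hadm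

/-- In a hypergraph without degree-`2` vertices on at least two vertices, all degrees are `≥ 3`. -/
theorem soloBlind_hg_three_le_deg {F : Finset W} {P : Finset (Finset W)} (hadm : soloBlindHgAdmissible F P)
    (hno : ∀ v ∈ F, soloBlindHgDeg P v ≠ 2) {u w : W} (hu : u ∈ F) (hw : w ∈ F) (huw : u ≠ w) :
    3 ≤ soloBlindHgDeg P u := by
  have h2 := soloBlind_hg_two_le_deg hadm hu hw huw
  have hne := hno u hu
  omega

end Summit.MatrixMultiplication.MatrixMultiplication.Theorems
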